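import Summits.QuantumFields.YangMills.Theorems.BalabanUVNodesN15TwoSpacingGluingSecondOrder
import Summits.QuantumFields.YangMills.Theorems.BalabanUVNodesN15TwoSpacingGluingCutRows
import HarnessLib

/-!
# THE GLUING STEP AT TWO LATTICE SPACINGS, XLI: ENTRIES 1, 2, 3 OF THE DRESSED PARAMETRIX FROM CUT ∕ SANDWICHED CUBE ROWS — the editions of FILES 48 and 54 for cube
# operators that are localized only AFTER a cut (Neumann-by-images cubes), one grid and two grids (dag-n15-c g13, FILE 83; N15 = NE2, s1 «background-layer OPERATOR ingredient»)

Cell `pub-ymgap`, seat `pub-ymgap-dag-n15-c` (R134 (a); HUMAN RULING D-0062), generation 13.  `bears_on: R4∕N15 · K3⁷ SpineGivenEndpointR13SepCoPH (stmt-QuantumFields-20544)`.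
Filed `--supports stmt-QuantumFields-20544 --as helper` — COUNT-NEUTRAL.  Theorems only (0 `def`, 0 `sorry`).  Imports BY NAME FILE 54 (`comp_parametrix_of_commOp`, through it FILES
43–53: `hasMaj_sandwich_loc`, `hasMaj_idef_sandwich_loc`, `hasMaj_comp_mulOp_loc`, `hasMaj_idef_comp_mulOp_loc`, `comp_parametrix_of_leibniz`, `parametrix_comp_of_leibniz`,
`hasMaj_sum_overlap`, `idef_fsum`) and FILE 63; generic over a [B6] geometry `g`, two lattices `X′ →π X`, blocks `blk`; nothing in the tree is modified.

WHY.  FILE 50's socket `ne2PlusOperator_glued_of_letters` consumes the bundle `GluedLetters` (entries 0–3 of the parametrix pair, the two remainders, their two-grid defects); FILE 55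
assembles it from TWO-SIDED rows of the UNCUT cube operators `G_□`, `D∘G_□`, `G_□∘E`, `D₃∘G_□`.  dag-n15-a's Neumann-by-images cubes `G(□) = Sym∘G∘M_{χ°}` are two-sided localized
only AFTER the output cut `M_{χ_□}` (their rows are `M_{χ_□}∘G(□)`, `M_{χ_□}∘∇_ν∘G(□)`, the sandwiched `(M_{χ_□}G(□))∘∇*_ν∘M_g = T₂∘M_g`, …).  FILE 63 treated entry 0 and the
remainder; this file treats ENTRIES 1, 2, 3: since the partition functions and their shifted ∕ differenced companions are supported where `χ_□ = 1` (FILE 65: `M_{h^s}M_χ = M_{h^s}`,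
`M_{dh}M_χ = M_{dh}`, `M_hM_χ = M_h`), every sandwich term of FILES 48∕54 equals the same sandwich of the CUT row, and the majorants ∕ η-defects follow from the cut rows verbatim.
* §1 entry 1 (left first-order factor `D`, Leibniz `D∘M_h = M_{h^s}∘D + M_{dh}`): ★★ `hasMaj_comp_parametrix_cut`, ★★ `hasMaj_idef_comp_parametrix_cut`;
* §2 entry 2 (right factor `E`, Leibniz `M_h∘E = E∘M_{h^s} + M_{dh}`, the cube's SANDWICHED identity `(M_χG_□)∘E∘M_{h^s} = T₂∘M_{h^s}` displayed as a hypothesis — dag-n15-a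
  `chiCube_neumannCubeG_comp_divAdj_mulOp` is its instance): ★★ `hasMaj_parametrix_comp_cut`, ★★ `hasMaj_idef_parametrix_comp_cut`;
* §3 entry 3 (any `D₃`, FILE 54's commutator form, with the `h`-WEIGHTED row `M_h∘D₃∘G_□` in place of `D₃∘G_□` — for the cubes `M_h∘ρ(sLap)∘G(□) = M_h − M_h∘M_χ∘N_L∘G(□)` by the
  exact locality): ★★ `hasMaj_comp_parametrix_of_commOp_h`, ★★ `hasMaj_idef_comp_parametrix_of_commOp_h`.
Same constants as FILES 48∕54.

HONEST FRAMING ∕ LIMITS.  Finite-dimensional bookkeeping over block majorants (no analytic estimate); [B6] (2.133)–(2.136) p.247 are SHAPES here, nothing of [B5]∕[B6]∕[B9] asserted;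
the rows are hypotheses (dag-n15-a's programme N ∕ P supply them at `U ≡ 1`).  NE2⁺ NOT PRINTED, NOT proved; N15 NOT discharged; counts of record UNMOVED (typed 28∕28 · discharged
5∕27); one finite 𝕋⁴ at fixed ε — NOT infinite volume, NOT OS on ℝ⁴, NOT a mass gap, NOT Clay; R4 closes the conditional finite-𝕋⁴ rung `BalabanLadder.UV` only.  Restate-immune.
-/

noncomputable section

namespace Summit.QuantumFields.YangMills.BalabanUVNodes.N15.Gluing

open Literature.MathematicalPhysics.QuantumFieldTheory.Balaban1983to89
open Literature.MathematicalPhysics.QuantumFieldTheory.Balaban1983to89.B11SectG (BlockNorm HasMaj)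
open Literature.MathematicalPhysics.QuantumFieldTheory.Balaban1983to89.T4EtaRateDefect (idef idef_add)
open Literature.MathematicalPhysics.QuantumFieldTheory.Balaban1983to89.T4EtaRateCoeffDefect (pull)
open Literature.MathematicalPhysics.QuantumFieldTheory.Balaban1983to89.B6Prop26Gluing (mulOp ind ind_nonneg)

/-! ## §1 Entry 1 from cut rows -/

section EntryOne

variable {X X' : Type} [Fintype X] [Fintype X'] {ι : Type} [Fintype ι] {g : B6.Geometry} (blk : X → g.Site) (π : X' → X) (S : ι → Set g.Site)

omit [Fintype X'] in
/-- ★★ **THE LEFT-DRESSED PARAMETRIX DECAYS, FROM CUT ROWS**: Leibniz `D∘M_{h_□} = M_{h^s_□}∘D + M_{dh_□}`, cuts `M_{h^s_□}∘M_{χ_□} = M_{h^s_□}`, `M_{dh_□}∘M_{χ_□} = M_{dh_□}`, CUT cube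
rows `M_{χ_□}∘G_□ ≤ 1_S1_S·βe^{−δd}`, `M_{χ_□}∘D∘G_□ ≤ 1_S1_S·β₁e^{−δd}`, `|h^s| ≤ c_s`, `|dh| ≤ c_d`, `|h| ≤ 1`, overlap `≤ N_ov` ⟹ `D∘G₀ ≤ N_ov(c_sβ₁ + c_dβ)e^{−δd}` (FILE 48's constant).
[cite: Balaban1984PropagatorsII, (2.133), (2.136) p.247 (shapes + mechanism), (2.37) p.229 (cut cubes)] -/
theorem hasMaj_comp_parametrix_cut {D : (X → ℝ) →ₗ[ℝ] (X → ℝ)} {h hs dh χ : ι → X → ℝ} {G : ι → (X → ℝ) →ₗ[ℝ] (X → ℝ)} {β β₁ cs cd δ Nov : ℝ}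
    (hβ : 0 ≤ β) (hβ₁ : 0 ≤ β₁) (hcs : 0 ≤ cs) (hcd : 0 ≤ cd) (hleib : ∀ i, D ∘ₗ mulOp (h i) = mulOp (hs i) ∘ₗ D + mulOp (dh i))
    (hcuts : ∀ i, mulOp (hs i) ∘ₗ mulOp (χ i) = mulOp (hs i)) (hcutd : ∀ i, mulOp (dh i) ∘ₗ mulOp (χ i) = mulOp (dh i))
    (hh : ∀ i x, |h i x| ≤ 1) (hhs : ∀ i x, |hs i x| ≤ cs) (hdh : ∀ i x, |dh i x| ≤ cd) (hN : ∀ a, ∑ i, ind (S i) a ≤ Nov)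
    (hGc : ∀ i, HasMaj (BlockNorm.ofBlocks g blk) (BlockNorm.ofBlocks g blk) (mulOp (χ i) ∘ₗ G i) (fun y y' => ind (S i) y * ind (S i) y' * (β * Real.exp (-(δ * g.dist y y')))))
    (hDGc : ∀ i, HasMaj (BlockNorm.ofBlocks g blk) (BlockNorm.ofBlocks g blk) (mulOp (χ i) ∘ₗ (D ∘ₗ G i))
      (fun y y' => ind (S i) y * ind (S i) y' * (β₁ * Real.exp (-(δ * g.dist y y'))))) :
    HasMaj (BlockNorm.ofBlocks g blk) (BlockNorm.ofBlocks g blk) (D ∘ₗ parametrix h G) (fun y y' => Nov * (cs * β₁ + cd * β) * Real.exp (-(δ * g.dist y y'))) := by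
  have hterm : ∀ i, HasMaj (BlockNorm.ofBlocks g blk) (BlockNorm.ofBlocks g blk) (mulOp (hs i) ∘ₗ (D ∘ₗ G i) ∘ₗ mulOp (h i) + mulOp (dh i) ∘ₗ G i ∘ₗ mulOp (h i))
      (fun y y' => ind (S i) y * ((cs * β₁ + cd * β) * Real.exp (-(δ * g.dist y y')))) := fun i => by
    have t1 := (hasMaj_sandwich_loc blk hcs zero_le_one hβ₁ (hhs i) (hh i) (hDGc i)).congr (T' := mulOp (hs i) ∘ₗ (D ∘ₗ G i) ∘ₗ mulOp (h i)) fun f => by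
      simp only [LinearMap.comp_apply]
      exact LinearMap.congr_fun (hcuts i) _
    have t2 := (hasMaj_sandwich_loc blk hcd zero_le_one hβ (hdh i) (hh i) (hGc i)).congr (T' := mulOp (dh i) ∘ₗ G i ∘ₗ mulOp (h i)) fun f => by
      simp only [LinearMap.comp_apply]
      exact LinearMap.congr_fun (hcutd i) _
    refine (t1.add t2).mono fun y y' => ?_
    have key := ind_mul_ind_le (Sc := S i) (A := (cs * β₁ + cd * β) * Real.exp (-(δ * g.dist y y'))) (mul_nonneg (by positivity) (Real.exp_nonneg _)) y y'
    calc ind (S i) y * ind (S i) y' * (cs * β₁ * 1 * Real.exp (-(δ * g.dist y y'))) + ind (S i) y * ind (S i) y' * (cd * β * 1 * Real.exp (-(δ * g.dist y y')))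
        = ind (S i) y * ind (S i) y' * ((cs * β₁ + cd * β) * Real.exp (-(δ * g.dist y y'))) := by ring
      _ ≤ _ := key
  rw [comp_parametrix_of_leibniz hleib]
  refine (hasMaj_sum_overlap _ S _ Nov (fun y y' => mul_nonneg (by positivity) (Real.exp_nonneg _)) hterm hN).mono fun y y' => le_of_eq ?_
  ring

/-- ★★ **THE η-DEFECT OF THE LEFT-DRESSED PARAMETRIX, FROM CUT ROWS**: FILE 48's `hasMaj_idef_comp_parametrix` with the cut rows `M_χ∘G_□`, `M_χ∘D∘G_□` (both spacings) and THEIR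
two-grid defects `𝔇(M_{χ′}G′_□, M_χG_□) ≤ 1_S1_S·m₀e^{−δd}`, `𝔇(M_{χ′}D′G′_□, M_χDG_□) ≤ 1_S1_S·m₁e^{−δd}`, under the cuts at both spacings; same constant
`N_ov[(c_sβ₁o + c_sm₁ + o_sβ₁) + (c_dβo + c_dm₀ + o_dβ)]`. [cite: Balaban1984PropagatorsII, (2.133), (2.136) p.247 (shapes); Balaban1985BackgroundPropagators, Thm 3.14
pp.426–427 (difference template)] -/
theorem hasMaj_idef_comp_parametrix_cut {D : (X → ℝ) →ₗ[ℝ] (X → ℝ)} {D' : (X' → ℝ) →ₗ[ℝ] (X' → ℝ)} {h hs dh χ : ι → X → ℝ} {h' hs' dh' χ' : ι → X' → ℝ}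
    {G : ι → (X → ℝ) →ₗ[ℝ] (X → ℝ)} {G' : ι → (X' → ℝ) →ₗ[ℝ] (X' → ℝ)} {β β₁ cs cd o os od m₀ m₁ δ Nov : ℝ} (hβ : 0 ≤ β) (hβ₁ : 0 ≤ β₁) (hcs : 0 ≤ cs) (hcd : 0 ≤ cd)
    (ho : 0 ≤ o) (hos : 0 ≤ os) (hod : 0 ≤ od) (hm₀ : 0 ≤ m₀) (hm₁ : 0 ≤ m₁)
    (hleib : ∀ i, D ∘ₗ mulOp (h i) = mulOp (hs i) ∘ₗ D + mulOp (dh i)) (hleib' : ∀ i, D' ∘ₗ mulOp (h' i) = mulOp (hs' i) ∘ₗ D' + mulOp (dh' i))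
    (hcuts : ∀ i, mulOp (hs i) ∘ₗ mulOp (χ i) = mulOp (hs i)) (hcutd : ∀ i, mulOp (dh i) ∘ₗ mulOp (χ i) = mulOp (dh i))
    (hcuts' : ∀ i, mulOp (hs' i) ∘ₗ mulOp (χ' i) = mulOp (hs' i)) (hcutd' : ∀ i, mulOp (dh' i) ∘ₗ mulOp (χ' i) = mulOp (dh' i))
    (hh : ∀ i x, |h i x| ≤ 1) (hhs' : ∀ i x', |hs' i x'| ≤ cs) (hdh' : ∀ i x', |dh' i x'| ≤ cd)
    (hfit : ∀ i x', |h' i x' - h i (π x')| ≤ o) (hfits : ∀ i x', |hs' i x' - hs i (π x')| ≤ os) (hfitd : ∀ i x', |dh' i x' - dh i (π x')| ≤ od)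
    (hN : ∀ a, ∑ i, ind (S i) a ≤ Nov)
    (hGc : ∀ i, HasMaj (BlockNorm.ofBlocks g blk) (BlockNorm.ofBlocks g blk) (mulOp (χ i) ∘ₗ G i) (fun y y' => ind (S i) y * ind (S i) y' * (β * Real.exp (-(δ * g.dist y y')))))
    (hGc' : ∀ i, HasMaj (BlockNorm.ofBlocks g (blk ∘ π)) (BlockNorm.ofBlocks g (blk ∘ π)) (mulOp (χ' i) ∘ₗ G' i)
      (fun y y' => ind (S i) y * ind (S i) y' * (β * Real.exp (-(δ * g.dist y y')))))
    (hDGc : ∀ i, HasMaj (BlockNorm.ofBlocks g blk) (BlockNorm.ofBlocks g blk) (mulOp (χ i) ∘ₗ (D ∘ₗ G i))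
      (fun y y' => ind (S i) y * ind (S i) y' * (β₁ * Real.exp (-(δ * g.dist y y')))))
    (hDGc' : ∀ i, HasMaj (BlockNorm.ofBlocks g (blk ∘ π)) (BlockNorm.ofBlocks g (blk ∘ π)) (mulOp (χ' i) ∘ₗ (D' ∘ₗ G' i))
      (fun y y' => ind (S i) y * ind (S i) y' * (β₁ * Real.exp (-(δ * g.dist y y')))))
    (hIGc : ∀ i, HasMaj (BlockNorm.ofBlocks g blk) (BlockNorm.ofBlocks g (blk ∘ π)) (idef (pull π) (pull π) (mulOp (χ' i) ∘ₗ G' i) (mulOp (χ i) ∘ₗ G i))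
      (fun y y' => ind (S i) y * ind (S i) y' * (m₀ * Real.exp (-(δ * g.dist y y')))))
    (hIDGc : ∀ i, HasMaj (BlockNorm.ofBlocks g blk) (BlockNorm.ofBlocks g (blk ∘ π)) (idef (pull π) (pull π) (mulOp (χ' i) ∘ₗ (D' ∘ₗ G' i)) (mulOp (χ i) ∘ₗ (D ∘ₗ G i)))
      (fun y y' => ind (S i) y * ind (S i) y' * (m₁ * Real.exp (-(δ * g.dist y y'))))) :
    HasMaj (BlockNorm.ofBlocks g blk) (BlockNorm.ofBlocks g (blk ∘ π)) (idef (pull π) (pull π) (D' ∘ₗ parametrix h' G') (D ∘ₗ parametrix h G))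
      (fun y y' => Nov * ((cs * β₁ * o + cs * m₁ * 1 + os * β₁ * 1) + (cd * β * o + cd * m₀ * 1 + od * β * 1)) * Real.exp (-(δ * g.dist y y'))) := by
  -- the sandwich terms with and without the cuts coincide
  have e1 : ∀ i, mulOp (hs i) ∘ₗ (mulOp (χ i) ∘ₗ (D ∘ₗ G i)) ∘ₗ mulOp (h i) = mulOp (hs i) ∘ₗ (D ∘ₗ G i) ∘ₗ mulOp (h i) := fun i =>
    LinearMap.ext fun f => by simp only [LinearMap.comp_apply]; exact LinearMap.congr_fun (hcuts i) _
  have e1' : ∀ i, mulOp (hs' i) ∘ₗ (mulOp (χ' i) ∘ₗ (D' ∘ₗ G' i)) ∘ₗ mulOp (h' i) = mulOp (hs' i) ∘ₗ (D' ∘ₗ G' i) ∘ₗ mulOp (h' i) := fun i =>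
    LinearMap.ext fun f => by simp only [LinearMap.comp_apply]; exact LinearMap.congr_fun (hcuts' i) _
  have e2 : ∀ i, mulOp (dh i) ∘ₗ (mulOp (χ i) ∘ₗ G i) ∘ₗ mulOp (h i) = mulOp (dh i) ∘ₗ G i ∘ₗ mulOp (h i) := fun i =>
    LinearMap.ext fun f => by simp only [LinearMap.comp_apply]; exact LinearMap.congr_fun (hcutd i) _
  have e2' : ∀ i, mulOp (dh' i) ∘ₗ (mulOp (χ' i) ∘ₗ G' i) ∘ₗ mulOp (h' i) = mulOp (dh' i) ∘ₗ G' i ∘ₗ mulOp (h' i) := fun i =>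
    LinearMap.ext fun f => by simp only [LinearMap.comp_apply]; exact LinearMap.congr_fun (hcutd' i) _
  have hterm : ∀ i, HasMaj (BlockNorm.ofBlocks g blk) (BlockNorm.ofBlocks g (blk ∘ π))
      (idef (pull π) (pull π) (mulOp (hs' i) ∘ₗ (D' ∘ₗ G' i) ∘ₗ mulOp (h' i) + mulOp (dh' i) ∘ₗ G' i ∘ₗ mulOp (h' i))
        (mulOp (hs i) ∘ₗ (D ∘ₗ G i) ∘ₗ mulOp (h i) + mulOp (dh i) ∘ₗ G i ∘ₗ mulOp (h i)))
      (fun y y' => ind (S i) y * (((cs * β₁ * o + cs * m₁ * 1 + os * β₁ * 1) + (cd * β * o + cd * m₀ * 1 + od * β * 1)) * Real.exp (-(δ * g.dist y y')))) := fun i => by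
    have t1 := hasMaj_idef_sandwich_loc blk π hcs zero_le_one hos ho hβ₁ hm₁ (hhs' i) (hh i) (hfits i) (hfit i) (hDGc i) (hDGc' i) (hIDGc i)
    have t2 := hasMaj_idef_sandwich_loc blk π hcd zero_le_one hod ho hβ hm₀ (hdh' i) (hh i) (hfitd i) (hfit i) (hGc i) (hGc' i) (hIGc i)
    rw [e1 i, e1' i] at t1
    rw [e2 i, e2' i] at t2
    rw [idef_add]
    refine (t1.add t2).mono fun y y' => ?_
    have key := ind_mul_ind_le (Sc := S i) (A := ((cs * β₁ * o + cs * m₁ * 1 + os * β₁ * 1) + (cd * β * o + cd * m₀ * 1 + od * β * 1)) * Real.exp (-(δ * g.dist y y')))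
      (mul_nonneg (by positivity) (Real.exp_nonneg _)) y y'
    calc ind (S i) y * ind (S i) y' * ((cs * β₁ * o + cs * m₁ * 1 + os * β₁ * 1) * Real.exp (-(δ * g.dist y y'))) +
          ind (S i) y * ind (S i) y' * ((cd * β * o + cd * m₀ * 1 + od * β * 1) * Real.exp (-(δ * g.dist y y')))
        = ind (S i) y * ind (S i) y' * (((cs * β₁ * o + cs * m₁ * 1 + os * β₁ * 1) + (cd * β * o + cd * m₀ * 1 + od * β * 1)) * Real.exp (-(δ * g.dist y y'))) := by ring
      _ ≤ _ := key
  rw [comp_parametrix_of_leibniz hleib, comp_parametrix_of_leibniz hleib', idef_fsum]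
  refine (hasMaj_sum_overlap _ S _ Nov (fun y y' => mul_nonneg (by positivity) (Real.exp_nonneg _)) hterm hN).mono fun y y' => le_of_eq ?_
  ring

end EntryOne

/-! ## §2 Entry 2 from cut ∕ sandwiched rows -/

section EntryTwo

variable {X X' : Type} [Fintype X] [Fintype X'] {ι : Type} [Fintype ι] {g : B6.Geometry} (blk : X → g.Site) (π : X' → X) (S : ι → Set g.Site)

omit [Fintype X'] in
/-- ★★ **THE RIGHT-DRESSED PARAMETRIX DECAYS, FROM CUT ∕ SANDWICHED ROWS**: Leibniz `M_{h_□}∘E = E∘M_{h^s_□} + M_{dh_□}`, cut `M_{h_□}∘M_{χ_□} = M_{h_□}`, the cube's SANDWICHED identity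
`(M_{χ_□}G_□)∘E∘M_{h^s_□} = T₂,□∘M_{h^s_□}` with `T₂,□ ≤ 1_S1_S·β₂e^{−δd}`, the cut row `M_{χ_□}G_□ ≤ 1_S1_S·βe^{−δd}`, `|h^s| ≤ c_s`, `|dh| ≤ c_d`, `|h| ≤ 1`, overlap `≤ N_ov` ⟹
`G₀∘E ≤ N_ov(β₂c_s + βc_d)e^{−δd}` (FILE 48's constant). [cite: Balaban1984PropagatorsII, (2.133), (2.136) p.247 (shapes + mechanism), (2.37) p.229] -/
theorem hasMaj_parametrix_comp_cut {E : (X → ℝ) →ₗ[ℝ] (X → ℝ)} {h hs dh χ : ι → X → ℝ} {G T₂ : ι → (X → ℝ) →ₗ[ℝ] (X → ℝ)} {β β₂ cs cd δ Nov : ℝ}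
    (hβ : 0 ≤ β) (hβ₂ : 0 ≤ β₂) (hcs : 0 ≤ cs) (hcd : 0 ≤ cd) (hleib : ∀ i, mulOp (h i) ∘ₗ E = E ∘ₗ mulOp (hs i) + mulOp (dh i))
    (hcut : ∀ i, mulOp (h i) ∘ₗ mulOp (χ i) = mulOp (h i)) (hE2 : ∀ i, mulOp (χ i) ∘ₗ G i ∘ₗ E ∘ₗ mulOp (hs i) = T₂ i ∘ₗ mulOp (hs i))
    (hh : ∀ i x, |h i x| ≤ 1) (hhs : ∀ i x, |hs i x| ≤ cs) (hdh : ∀ i x, |dh i x| ≤ cd) (hN : ∀ a, ∑ i, ind (S i) a ≤ Nov)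
    (hGc : ∀ i, HasMaj (BlockNorm.ofBlocks g blk) (BlockNorm.ofBlocks g blk) (mulOp (χ i) ∘ₗ G i) (fun y y' => ind (S i) y * ind (S i) y' * (β * Real.exp (-(δ * g.dist y y')))))
    (hT2 : ∀ i, HasMaj (BlockNorm.ofBlocks g blk) (BlockNorm.ofBlocks g blk) (T₂ i) (fun y y' => ind (S i) y * ind (S i) y' * (β₂ * Real.exp (-(δ * g.dist y y'))))) :
    HasMaj (BlockNorm.ofBlocks g blk) (BlockNorm.ofBlocks g blk) (parametrix h G ∘ₗ E) (fun y y' => Nov * (β₂ * cs + β * cd) * Real.exp (-(δ * g.dist y y'))) := by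
  have hterm : ∀ i, HasMaj (BlockNorm.ofBlocks g blk) (BlockNorm.ofBlocks g blk) (mulOp (h i) ∘ₗ (G i ∘ₗ E) ∘ₗ mulOp (hs i) + mulOp (h i) ∘ₗ G i ∘ₗ mulOp (dh i))
      (fun y y' => ind (S i) y * ((β₂ * cs + β * cd) * Real.exp (-(δ * g.dist y y')))) := fun i => by
    have t1 := (hasMaj_sandwich_loc blk zero_le_one hcs hβ₂ (hh i) (hhs i) (hT2 i)).congr (T' := mulOp (h i) ∘ₗ (G i ∘ₗ E) ∘ₗ mulOp (hs i)) fun f => by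
      have h1 := LinearMap.congr_fun (hE2 i) f
      have h2 := LinearMap.congr_fun (hcut i) (G i (E (mulOp (hs i) f)))
      simp only [LinearMap.comp_apply] at h1 h2 ⊢
      rw [← h1, h2]
    have t2 := (hasMaj_sandwich_loc blk zero_le_one hcd hβ (hh i) (hdh i) (hGc i)).congr (T' := mulOp (h i) ∘ₗ G i ∘ₗ mulOp (dh i)) fun f => by
      simp only [LinearMap.comp_apply]
      exact LinearMap.congr_fun (hcut i) _
    refine (t1.add t2).mono fun y y' => ?_
    have key := ind_mul_ind_le (Sc := S i) (A := (β₂ * cs + β * cd) * Real.exp (-(δ * g.dist y y'))) (mul_nonneg (by positivity) (Real.exp_nonneg _)) y y'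
    calc ind (S i) y * ind (S i) y' * (1 * β₂ * cs * Real.exp (-(δ * g.dist y y'))) + ind (S i) y * ind (S i) y' * (1 * β * cd * Real.exp (-(δ * g.dist y y')))
        = ind (S i) y * ind (S i) y' * ((β₂ * cs + β * cd) * Real.exp (-(δ * g.dist y y'))) := by ring
      _ ≤ _ := key
  rw [parametrix_comp_of_leibniz hleib]
  refine (hasMaj_sum_overlap _ S _ Nov (fun y y' => mul_nonneg (by positivity) (Real.exp_nonneg _)) hterm hN).mono fun y y' => le_of_eq ?_
  ring

/-- ★★ **THE η-DEFECT OF THE RIGHT-DRESSED PARAMETRIX, FROM CUT ∕ SANDWICHED ROWS**: FILE 48's `hasMaj_idef_parametrix_comp` with the sandwiched entry-2 operators `T₂,□`, `T₂′,□` (their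
rows `β₂` and two-grid defect `m₂`), the cut rows (`β`, defect `m₀`), the Leibniz data and cuts at both spacings, the fits; same constant. [cite: Balaban1984PropagatorsII, (2.133),
(2.136) p.247 (shapes); Balaban1985BackgroundPropagators, Thm 3.14 pp.426–427 (difference template)] -/
theorem hasMaj_idef_parametrix_comp_cut {E : (X → ℝ) →ₗ[ℝ] (X → ℝ)} {E' : (X' → ℝ) →ₗ[ℝ] (X' → ℝ)} {h hs dh χ : ι → X → ℝ} {h' hs' dh' χ' : ι → X' → ℝ}
    {G T₂ : ι → (X → ℝ) →ₗ[ℝ] (X → ℝ)} {G' T₂' : ι → (X' → ℝ) →ₗ[ℝ] (X' → ℝ)} {β β₂ cs cd o os od m₀ m₂ δ Nov : ℝ} (hβ : 0 ≤ β) (hβ₂ : 0 ≤ β₂) (hcs : 0 ≤ cs)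
    (hcd : 0 ≤ cd) (ho : 0 ≤ o) (hos : 0 ≤ os) (hod : 0 ≤ od) (hm₀ : 0 ≤ m₀) (hm₂ : 0 ≤ m₂)
    (hleib : ∀ i, mulOp (h i) ∘ₗ E = E ∘ₗ mulOp (hs i) + mulOp (dh i)) (hleib' : ∀ i, mulOp (h' i) ∘ₗ E' = E' ∘ₗ mulOp (hs' i) + mulOp (dh' i))
    (hcut : ∀ i, mulOp (h i) ∘ₗ mulOp (χ i) = mulOp (h i)) (hcut' : ∀ i, mulOp (h' i) ∘ₗ mulOp (χ' i) = mulOp (h' i))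
    (hE2 : ∀ i, mulOp (χ i) ∘ₗ G i ∘ₗ E ∘ₗ mulOp (hs i) = T₂ i ∘ₗ mulOp (hs i)) (hE2' : ∀ i, mulOp (χ' i) ∘ₗ G' i ∘ₗ E' ∘ₗ mulOp (hs' i) = T₂' i ∘ₗ mulOp (hs' i))
    (hh' : ∀ i x', |h' i x'| ≤ 1) (hhs : ∀ i x, |hs i x| ≤ cs) (hdh : ∀ i x, |dh i x| ≤ cd)
    (hfit : ∀ i x', |h' i x' - h i (π x')| ≤ o) (hfits : ∀ i x', |hs' i x' - hs i (π x')| ≤ os) (hfitd : ∀ i x', |dh' i x' - dh i (π x')| ≤ od)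
    (hN : ∀ a, ∑ i, ind (S i) a ≤ Nov)
    (hGc : ∀ i, HasMaj (BlockNorm.ofBlocks g blk) (BlockNorm.ofBlocks g blk) (mulOp (χ i) ∘ₗ G i) (fun y y' => ind (S i) y * ind (S i) y' * (β * Real.exp (-(δ * g.dist y y')))))
    (hGc' : ∀ i, HasMaj (BlockNorm.ofBlocks g (blk ∘ π)) (BlockNorm.ofBlocks g (blk ∘ π)) (mulOp (χ' i) ∘ₗ G' i)
      (fun y y' => ind (S i) y * ind (S i) y' * (β * Real.exp (-(δ * g.dist y y')))))
    (hT2 : ∀ i, HasMaj (BlockNorm.ofBlocks g blk) (BlockNorm.ofBlocks g blk) (T₂ i) (fun y y' => ind (S i) y * ind (S i) y' * (β₂ * Real.exp (-(δ * g.dist y y')))))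
    (hT2' : ∀ i, HasMaj (BlockNorm.ofBlocks g (blk ∘ π)) (BlockNorm.ofBlocks g (blk ∘ π)) (T₂' i) (fun y y' => ind (S i) y * ind (S i) y' * (β₂ * Real.exp (-(δ * g.dist y y')))))
    (hIGc : ∀ i, HasMaj (BlockNorm.ofBlocks g blk) (BlockNorm.ofBlocks g (blk ∘ π)) (idef (pull π) (pull π) (mulOp (χ' i) ∘ₗ G' i) (mulOp (χ i) ∘ₗ G i))
      (fun y y' => ind (S i) y * ind (S i) y' * (m₀ * Real.exp (-(δ * g.dist y y')))))
    (hIT2 : ∀ i, HasMaj (BlockNorm.ofBlocks g blk) (BlockNorm.ofBlocks g (blk ∘ π)) (idef (pull π) (pull π) (T₂' i) (T₂ i))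
      (fun y y' => ind (S i) y * ind (S i) y' * (m₂ * Real.exp (-(δ * g.dist y y'))))) :
    HasMaj (BlockNorm.ofBlocks g blk) (BlockNorm.ofBlocks g (blk ∘ π)) (idef (pull π) (pull π) (parametrix h' G' ∘ₗ E') (parametrix h G ∘ₗ E))
      (fun y y' => Nov * ((1 * β₂ * os + 1 * m₂ * cs + o * β₂ * cs) + (1 * β * od + 1 * m₀ * cd + o * β * cd)) * Real.exp (-(δ * g.dist y y'))) := by
  have e1 : ∀ i, mulOp (h i) ∘ₗ T₂ i ∘ₗ mulOp (hs i) = mulOp (h i) ∘ₗ (G i ∘ₗ E) ∘ₗ mulOp (hs i) := fun i => LinearMap.ext fun f => by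
    have h1 := LinearMap.congr_fun (hE2 i) f
    have h2 := LinearMap.congr_fun (hcut i) (G i (E (mulOp (hs i) f)))
    simp only [LinearMap.comp_apply] at h1 h2 ⊢
    rw [← h1, h2]
  have e1' : ∀ i, mulOp (h' i) ∘ₗ T₂' i ∘ₗ mulOp (hs' i) = mulOp (h' i) ∘ₗ (G' i ∘ₗ E') ∘ₗ mulOp (hs' i) := fun i => LinearMap.ext fun f => by
    have h1 := LinearMap.congr_fun (hE2' i) f
    have h2 := LinearMap.congr_fun (hcut' i) (G' i (E' (mulOp (hs' i) f)))
    simp only [LinearMap.comp_apply] at h1 h2 ⊢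
    rw [← h1, h2]
  have e2 : ∀ i, mulOp (h i) ∘ₗ (mulOp (χ i) ∘ₗ G i) ∘ₗ mulOp (dh i) = mulOp (h i) ∘ₗ G i ∘ₗ mulOp (dh i) := fun i =>
    LinearMap.ext fun f => by simp only [LinearMap.comp_apply]; exact LinearMap.congr_fun (hcut i) _
  have e2' : ∀ i, mulOp (h' i) ∘ₗ (mulOp (χ' i) ∘ₗ G' i) ∘ₗ mulOp (dh' i) = mulOp (h' i) ∘ₗ G' i ∘ₗ mulOp (dh' i) := fun i =>
    LinearMap.ext fun f => by simp only [LinearMap.comp_apply]; exact LinearMap.congr_fun (hcut' i) _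
  have hterm : ∀ i, HasMaj (BlockNorm.ofBlocks g blk) (BlockNorm.ofBlocks g (blk ∘ π))
      (idef (pull π) (pull π) (mulOp (h' i) ∘ₗ (G' i ∘ₗ E') ∘ₗ mulOp (hs' i) + mulOp (h' i) ∘ₗ G' i ∘ₗ mulOp (dh' i))
        (mulOp (h i) ∘ₗ (G i ∘ₗ E) ∘ₗ mulOp (hs i) + mulOp (h i) ∘ₗ G i ∘ₗ mulOp (dh i)))
      (fun y y' => ind (S i) y * (((1 * β₂ * os + 1 * m₂ * cs + o * β₂ * cs) + (1 * β * od + 1 * m₀ * cd + o * β * cd)) * Real.exp (-(δ * g.dist y y')))) := fun i => by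
    have t1 := hasMaj_idef_sandwich_loc blk π zero_le_one hcs ho hos hβ₂ hm₂ (hh' i) (hhs i) (hfit i) (hfits i) (hT2 i) (hT2' i) (hIT2 i)
    have t2 := hasMaj_idef_sandwich_loc blk π zero_le_one hcd ho hod hβ hm₀ (hh' i) (hdh i) (hfit i) (hfitd i) (hGc i) (hGc' i) (hIGc i)
    rw [e1 i, e1' i] at t1
    rw [e2 i, e2' i] at t2
    rw [idef_add]
    refine (t1.add t2).mono fun y y' => ?_
    have key := ind_mul_ind_le (Sc := S i) (A := ((1 * β₂ * os + 1 * m₂ * cs + o * β₂ * cs) + (1 * β * od + 1 * m₀ * cd + o * β * cd)) * Real.exp (-(δ * g.dist y y')))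
      (mul_nonneg (by positivity) (Real.exp_nonneg _)) y y'
    calc ind (S i) y * ind (S i) y' * ((1 * β₂ * os + 1 * m₂ * cs + o * β₂ * cs) * Real.exp (-(δ * g.dist y y'))) +
          ind (S i) y * ind (S i) y' * ((1 * β * od + 1 * m₀ * cd + o * β * cd) * Real.exp (-(δ * g.dist y y')))
        = ind (S i) y * ind (S i) y' * (((1 * β₂ * os + 1 * m₂ * cs + o * β₂ * cs) + (1 * β * od + 1 * m₀ * cd + o * β * cd)) * Real.exp (-(δ * g.dist y y'))) := by
          ring
      _ ≤ _ := key
  rw [parametrix_comp_of_leibniz hleib, parametrix_comp_of_leibniz hleib', idef_fsum]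
  refine (hasMaj_sum_overlap _ S _ Nov (fun y y' => mul_nonneg (by positivity) (Real.exp_nonneg _)) hterm hN).mono fun y y' => le_of_eq ?_
  ring

end EntryTwo

/-! ## §3 Entry 3 with the `h`-weighted row -/

section EntryThree

variable {X X' : Type} [Fintype X] [Fintype X'] {K : Type} [Fintype K] {g : B6.Geometry} (blk : X → g.Site) (π : X' → X) (S : K → Set g.Site)

omit [Fintype X'] in
/-- ★★ **THE SECOND-ORDER DRESSED PARAMETRIX DECAYS, FROM THE `h`-WEIGHTED ROW**: FILE 54's `hasMaj_comp_parametrix_of_commOp` with the entry-3 row in the form `M_{h_□}∘D₃∘G_□ ≤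
1_S1_S·β₃e^{−δd}` (the weight on the LEFT of `D₃`: what the exact per-cube locality delivers for `D₃ = ρ(sLap) = Δ_a − N_L`) and the commutator rows `[D₃, M_{h_□}]∘G_□ ≤ 1_S1_S·θ₀e^{−δd}`
⟹ `D₃∘G₀ ≤ N_ov(β₃ + θ₀)e^{−δd}`. [cite: Balaban1984PropagatorsII, (2.133), (2.136) p.247 (shapes + mechanism); Balaban1985BackgroundPropagators, (3.42) p.397 (entry 3: shape)] -/
theorem hasMaj_comp_parametrix_of_commOp_h {D₃ : (X → ℝ) →ₗ[ℝ] (X → ℝ)} {h : K → X → ℝ} {G : K → (X → ℝ) →ₗ[ℝ] (X → ℝ)} {β₃ θ₀ δ Nov : ℝ} (hβ₃ : 0 ≤ β₃) (hθ : 0 ≤ θ₀)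
    (hh : ∀ i x, |h i x| ≤ 1) (hN : ∀ a, ∑ i, ind (S i) a ≤ Nov)
    (hE3 : ∀ i, HasMaj (BlockNorm.ofBlocks g blk) (BlockNorm.ofBlocks g blk) (mulOp (h i) ∘ₗ (D₃ ∘ₗ G i))
      (fun y y' => ind (S i) y * ind (S i) y' * (β₃ * Real.exp (-(δ * g.dist y y')))))
    (hKc : ∀ i, HasMaj (BlockNorm.ofBlocks g blk) (BlockNorm.ofBlocks g blk) (commOp D₃ (h i) ∘ₗ G i)
      (fun y y' => ind (S i) y * ind (S i) y' * (θ₀ * Real.exp (-(δ * g.dist y y'))))) :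
    HasMaj (BlockNorm.ofBlocks g blk) (BlockNorm.ofBlocks g blk) (D₃ ∘ₗ parametrix h G) (fun y y' => Nov * (β₃ + θ₀) * Real.exp (-(δ * g.dist y y'))) := by
  have hterm : ∀ i, HasMaj (BlockNorm.ofBlocks g blk) (BlockNorm.ofBlocks g blk) (mulOp (h i) ∘ₗ (D₃ ∘ₗ G i) ∘ₗ mulOp (h i) + (commOp D₃ (h i) ∘ₗ G i) ∘ₗ mulOp (h i))
      (fun y y' => ind (S i) y * ((β₃ + θ₀) * Real.exp (-(δ * g.dist y y')))) := fun i => by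
    have t1 := (hasMaj_comp_mulOp_loc blk hβ₃ zero_le_one (hh i) (hE3 i)).congr (T' := mulOp (h i) ∘ₗ (D₃ ∘ₗ G i) ∘ₗ mulOp (h i)) fun f => rfl
    have t2 := hasMaj_comp_mulOp_loc blk hθ zero_le_one (hh i) (hKc i)
    refine (t1.add t2).mono fun y y' => ?_
    have key := ind_mul_ind_le (Sc := S i) (A := (β₃ + θ₀) * Real.exp (-(δ * g.dist y y'))) (mul_nonneg (by positivity) (Real.exp_nonneg _)) y y'
    calc ind (S i) y * ind (S i) y' * (β₃ * 1 * Real.exp (-(δ * g.dist y y'))) + ind (S i) y * ind (S i) y' * (θ₀ * 1 * Real.exp (-(δ * g.dist y y')))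
        = ind (S i) y * ind (S i) y' * ((β₃ + θ₀) * Real.exp (-(δ * g.dist y y'))) := by ring
      _ ≤ _ := key
  rw [comp_parametrix_of_commOp]
  refine (hasMaj_sum_overlap _ S _ Nov (fun y y' => mul_nonneg (by positivity) (Real.exp_nonneg _)) hterm hN).mono fun y y' => le_of_eq ?_
  ring

/-- ★★ **THE η-DEFECT OF THE SECOND-ORDER DRESSED PARAMETRIX, FROM THE `h`-WEIGHTED ROWS**: the fine weighted row `M_{h′_□}D₃′G′_□` (`β₃`), its two-grid defect against the coarse one
(`m₃`), the fine commutator rows (`θ₀`) and their defects (`r`), `|h| ≤ 1`, the fit `o`, overlap `≤ N_ov` ⟹ `𝔇(D₃′∘G₀′, D₃∘G₀) ≤ N_ov·((β₃o + m₃) + (θ₀o + r))·e^{−δd}`.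
[cite: Balaban1984PropagatorsII, (2.136) p.247 (shapes); Balaban1985BackgroundPropagators, Thm 3.14 pp.426–427 (difference template)] -/
theorem hasMaj_idef_comp_parametrix_of_commOp_h {D₃ : (X → ℝ) →ₗ[ℝ] (X → ℝ)} {D₃' : (X' → ℝ) →ₗ[ℝ] (X' → ℝ)} {h : K → X → ℝ} {h' : K → X' → ℝ}
    {G : K → (X → ℝ) →ₗ[ℝ] (X → ℝ)} {G' : K → (X' → ℝ) →ₗ[ℝ] (X' → ℝ)} {β₃ θ₀ o m₃ r δ Nov : ℝ} (hβ₃ : 0 ≤ β₃) (hθ : 0 ≤ θ₀) (ho : 0 ≤ o) (hm₃ : 0 ≤ m₃) (hr : 0 ≤ r)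
    (hh : ∀ i x, |h i x| ≤ 1) (hfit : ∀ i x', |h' i x' - h i (π x')| ≤ o) (hN : ∀ a, ∑ i, ind (S i) a ≤ Nov)
    (hE3' : ∀ i, HasMaj (BlockNorm.ofBlocks g (blk ∘ π)) (BlockNorm.ofBlocks g (blk ∘ π)) (mulOp (h' i) ∘ₗ (D₃' ∘ₗ G' i))
      (fun y y' => ind (S i) y * ind (S i) y' * (β₃ * Real.exp (-(δ * g.dist y y')))))
    (hKc' : ∀ i, HasMaj (BlockNorm.ofBlocks g (blk ∘ π)) (BlockNorm.ofBlocks g (blk ∘ π)) (commOp D₃' (h' i) ∘ₗ G' i)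
      (fun y y' => ind (S i) y * ind (S i) y' * (θ₀ * Real.exp (-(δ * g.dist y y')))))
    (hIE3 : ∀ i, HasMaj (BlockNorm.ofBlocks g blk) (BlockNorm.ofBlocks g (blk ∘ π)) (idef (pull π) (pull π) (mulOp (h' i) ∘ₗ (D₃' ∘ₗ G' i)) (mulOp (h i) ∘ₗ (D₃ ∘ₗ G i)))
      (fun y y' => ind (S i) y * ind (S i) y' * (m₃ * Real.exp (-(δ * g.dist y y')))))
    (hDK : ∀ i, HasMaj (BlockNorm.ofBlocks g blk) (BlockNorm.ofBlocks g (blk ∘ π)) (idef (pull π) (pull π) (commOp D₃' (h' i) ∘ₗ G' i) (commOp D₃ (h i) ∘ₗ G i))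
      (fun y y' => ind (S i) y * ind (S i) y' * (r * Real.exp (-(δ * g.dist y y'))))) :
    HasMaj (BlockNorm.ofBlocks g blk) (BlockNorm.ofBlocks g (blk ∘ π)) (idef (pull π) (pull π) (D₃' ∘ₗ parametrix h' G') (D₃ ∘ₗ parametrix h G))
      (fun y y' => Nov * ((β₃ * o + m₃) + (θ₀ * o + r)) * Real.exp (-(δ * g.dist y y'))) := by
  have e3 : ∀ i, (mulOp (h i) ∘ₗ (D₃ ∘ₗ G i)) ∘ₗ mulOp (h i) = mulOp (h i) ∘ₗ (D₃ ∘ₗ G i) ∘ₗ mulOp (h i) := fun i => rfl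
  have e3' : ∀ i, (mulOp (h' i) ∘ₗ (D₃' ∘ₗ G' i)) ∘ₗ mulOp (h' i) = mulOp (h' i) ∘ₗ (D₃' ∘ₗ G' i) ∘ₗ mulOp (h' i) := fun i => rfl
  have hterm : ∀ i, HasMaj (BlockNorm.ofBlocks g blk) (BlockNorm.ofBlocks g (blk ∘ π))
      (idef (pull π) (pull π) (mulOp (h' i) ∘ₗ (D₃' ∘ₗ G' i) ∘ₗ mulOp (h' i) + (commOp D₃' (h' i) ∘ₗ G' i) ∘ₗ mulOp (h' i))
        (mulOp (h i) ∘ₗ (D₃ ∘ₗ G i) ∘ₗ mulOp (h i) + (commOp D₃ (h i) ∘ₗ G i) ∘ₗ mulOp (h i)))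
      (fun y y' => ind (S i) y * (((β₃ * o + m₃) + (θ₀ * o + r)) * Real.exp (-(δ * g.dist y y')))) := fun i => by
    have t1 := hasMaj_idef_comp_mulOp_loc blk π hβ₃ hm₃ zero_le_one ho (hh i) (hfit i) (hE3' i) (hIE3 i)
    have t2 := hasMaj_idef_comp_mulOp_loc blk π hθ hr zero_le_one ho (hh i) (hfit i) (hKc' i) (hDK i)
    rw [e3 i, e3' i] at t1
    rw [idef_add]
    refine (t1.add t2).mono fun y y' => ?_
    have key := ind_mul_ind_le (Sc := S i) (A := ((β₃ * o + m₃) + (θ₀ * o + r)) * Real.exp (-(δ * g.dist y y'))) (mul_nonneg (by positivity) (Real.exp_nonneg _)) y y'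
    calc ind (S i) y * ind (S i) y' * ((β₃ * o + m₃ * 1) * Real.exp (-(δ * g.dist y y'))) +
          ind (S i) y * ind (S i) y' * ((θ₀ * o + r * 1) * Real.exp (-(δ * g.dist y y')))
        = ind (S i) y * ind (S i) y' * (((β₃ * o + m₃) + (θ₀ * o + r)) * Real.exp (-(δ * g.dist y y'))) := by ring
      _ ≤ _ := key
  rw [comp_parametrix_of_commOp, comp_parametrix_of_commOp, idef_fsum]
  refine (hasMaj_sum_overlap _ S _ Nov (fun y y' => mul_nonneg (by positivity) (Real.exp_nonneg _)) hterm hN).mono fun y y' => le_of_eq ?_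
  ring

end EntryThree

end Summit.QuantumFields.YangMills.BalabanUVNodes.N15.Gluing

end
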